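import Summits.AtomisticToContinuum.Crystallization.Theorems.FrustratedLawDichotomyStrainedPatchStiffDoor

/-!
# Strained patch — «KernelCutSector»: the record T-cell (N|𝔇) of SECTOR-95 as the tree's KERNEL CUT (enclosure ∧ pair-kernel certificate) — lens-5 g96, critic ORDER r1578

The one remaining IDEA-NEEDED cell on the door / record side of SECTOR-95,
  (N|𝔇) `RefineGB (famAnd (famAnd 𝓘₀ (Dense dA)) 𝓡) 𝓗 (26/5) (1/100) (1/8) (1/25) (constTol (1/25)) (1/25) (constTol (1/25)) (relConeBy 2 (stepByF 𝓡 βf₁ βf₂) (stepByF 𝓡 sf₁ sf₂) (1/25))`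
(`…StrainedPatchStiffDoor.aperiodicFrustratedLawGap_of_threeSector_A35000_T26_record`, hypothesis `hND`), is read through the LANDED g86 kernel cut
`…StrainedPatchKernelCutA` (imported via `…ConeAnatomy`), NOT restated: (R) `BalancedRefit` ∧ (E) `SlavingEnclosureG` ∧ (P₀) `PairKernelCert` ⟹ (D_GB)
(`refineGB_of_kernelCut`).  What this file adds is only the SECTOR bookkeeping: the refit stays inside the coarse cell family `𝓘_N := famAnd (famAnd 𝓘₀ (Dense dA)) 𝓡`
(identity refit `balancedRefit_top`, or any balance `𝓑`) and is pushed into the hull family `𝓗 ⊇ 𝓘_N` by `RefineGB.mono`; on `𝓡`-hosts the glued functional is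
the record one (`pairKernelCert_stepByF_of_pos`).
  (N|𝔇) ⟸ (E κ)  `SlavingEnclosureG 𝓘_N balTop (26/5) (1/100) (1/8) (1/25) (constTol (1/25)) κ σ H F X`     [ANALYTIC · UNDECIDED — the structured second-order force remainder]
        ∧ (P₀ κ) `PairKernelCert 𝓘_N balTop (1/25) (constTol (1/25)) κ σ H F X (1/25) (constTol (1/25)) (relConeBy 2 βf₁ sf₁ (1/25))`   [INSTRUMENTABLE «HTN-LP-96»]
        ∧ `𝓘_N ≤ 𝓗`   — `refineGB_ND_of_kernelCut_top`; general balance: `refineGB_ND_of_kernelCut`; the crux BY NAME with `hND` so replaced —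
  `aperiodicFrustratedLawGap_of_threeSector_kernelCut_A35000_T26_record`.
THE INSTRUMENT (memo `g96/memo/HTNLP96-SPEC.md`, engine `g96/num/htnlp96.py`, kit-ready, dry-tested): (P₀ 0) per host at TRUE SIZE `R = 63/10` — identity host,
identity labels, sound slack column `X = X_far + X_H + X_cut + X_unc` (hard-core tail of the uncharted exterior by the subharmonic mean-value bound · Hessian truncation ·
cutoff shell · rim-uncertain sites), 98-facet site boxes, 26-facet force rows, two-stage 26/130-direction objectives per S₁ pair orbit; desk prediction MARGINAL (±20 %) on
the outer S₁ shells against the free band `r ≳ 4.6–4.9`; the `rem/σ₁` column of the run measures the `κ` that (E κ) must carry.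
[formal bookkeeping] 0 sorry · no new axioms · no cite tokens · no instances / notation · no new `def`.
-/

open scoped BigOperators Classical RealInnerProductSpace
open Summit.AtomisticToContinuum.Crystallization.Theorems.ChargedEnergyGapNegative (eStar E3)
open Summit.AtomisticToContinuum.Crystallization.Theorems.FrustratedLawDichotomyRangeCut
open Summit.AtomisticToContinuum.Crystallization.Theorems.FrustratedLawDichotomySchurCut
open Summit.AtomisticToContinuum.Crystallization.Theorems.FrustratedLawDichotomyMotifLemmas (GoodAtScale)
open Summit.AtomisticToContinuum.Crystallization.Theorems.FrustratedLawDichotomyAveragingCut (ballAvg)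
open Summit.AtomisticToContinuum.Crystallization.Theorems.FrustratedLawDichotomyExemptLocOpt (LocOptFails)
open Summit.AtomisticToContinuum.Crystallization.Theorems.FrustratedLawDichotomyExemptSplit (SchurElasticPricingX)
open Summit.AtomisticToContinuum.Crystallization.Theorems.FrustratedLawDichotomyExemptAbsorptionRecord
open Summit.AtomisticToContinuum.Crystallization.Theorems.FrustratedLawDichotomyCollarCensus
open Summit.AtomisticToContinuum.Crystallization.Theorems.FrustratedLawDichotomyCollarCensusKappa
open Summit.AtomisticToContinuum.Crystallization.Theorems.FrustratedLawDichotomyStrainedPatchHomSplit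
open Summit.AtomisticToContinuum.Crystallization.Theorems.FrustratedLawDichotomyStrainedPatchCleanCollar (CleanBall TailPenalty AnnularDefectFloor
  DefectiveCollarFloor tailOut)
open Summit.AtomisticToContinuum.Crystallization.Theorems.FrustratedLawDichotomyStrainedPatchPhaseCut (MonoPhaseBall AnnularPhaseFloor PolyTextureFloor)
open Summit.AtomisticToContinuum.Crystallization.Theorems.FrustratedLawDichotomyStrainedPatchCoreTube (NearHomIsoAt CoreOffTubeFloor)
open Summit.AtomisticToContinuum.Crystallization.Theorems.FrustratedLawDichotomyStrainedPatchCoreTubeRecord (CoreCoreRelief)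
open Summit.AtomisticToContinuum.Crystallization.Theorems.FrustratedLawDichotomyStrainedPatchChartFamilies (ChartBy FamilyLE familyLE_refl)
open Summit.AtomisticToContinuum.Crystallization.Theorems.FrustratedLawDichotomyStrainedPatchQuantSlaving
open Summit.AtomisticToContinuum.Crystallization.Theorems.FrustratedLawDichotomyStrainedPatchHostCells (TubeFloor)
open Summit.AtomisticToContinuum.Crystallization.Theorems.FrustratedLawDichotomyStrainedPatchGradedTube
open Summit.AtomisticToContinuum.Crystallization.Theorems.FrustratedLawDichotomyStrainedPatchCoverBridge
open Summit.AtomisticToContinuum.Crystallization.Theorems.FrustratedLawDichotomyStrainedPatchPairTube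
open Summit.AtomisticToContinuum.Crystallization.Theorems.FrustratedLawDichotomyStrainedPatchKernelCut
open Summit.AtomisticToContinuum.Crystallization.Theorems.FrustratedLawDichotomyStrainedPatchHomCertTree (CertTree treeOK)
open Summit.AtomisticToContinuum.Crystallization.Theorems.FrustratedLawDichotomyStrainedPatchHomEntryGram (rootC rootW)
open Summit.AtomisticToContinuum.Crystallization.Theorems.FrustratedLawDichotomyStrainedPatchHomEntryGramHcp (rootCH rootWH)
open Summit.AtomisticToContinuum.Crystallization.Theorems.FrustratedLawDichotomyStrainedPatchHomEntryLeafHT (entryLeafOK6RBKP4 semOKH)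
open Summit.AtomisticToContinuum.Crystallization.Theorems.FrustratedLawDichotomyAperiodicGapRecordJunctionHomFloorF6pT26
open Summit.AtomisticToContinuum.Crystallization.Theorems.FrustratedLawDichotomyStrainedPatchConeAnatomy
open Summit.AtomisticToContinuum.Crystallization.Theorems.FrustratedLawDichotomyStrainedPatchStiffSector
open Summit.AtomisticToContinuum.Crystallization.Theorems.FrustratedLawDichotomyStrainedPatchStiffDoor

namespace Summit.AtomisticToContinuum.Crystallization.Theorems.FrustratedLawDichotomyStrainedPatchKernelCutSector

/-! ## §1. Bookkeeping on the kernel-cut certificate (P₀) -/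

section Cert

variable {𝓘 : ChartFam} {𝓑 : BalPred} {τ₁ τ κ σ : ℝ} {T₁ T : SlackTab} {H : HessTab} {F : ForceTab} {X : SlackTab} {B : PairTab}

/-- ★ POSITIVE CONTROL: at the same data the KINEMATIC table `pairSum T` needs no certificate (`chartByGB_pairSum_iff`); the content of (P₀) at `relConeBy` is on
the score-relevant pairs only. [formal bookkeeping] -/
theorem pairKernelCert_pairSum : PairKernelCert 𝓘 𝓑 τ T κ σ H F X τ T (pairSum T) :=
  fun _ _ _ _ _ _ _ hch _ _ => chartByGB_pairSum_iff.2 hch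

/-- ★ On hosts OF the class `𝓟` the glued functional `stepByF 𝓟 f g` IS `f`: a certificate at `relConeBy RE βf₁ sf₁ τ₀` on the family `𝓘 ∧ 𝓟` is one at the
glued table `relConeBy RE (stepByF 𝓟 βf₁ βf₂) (stepByF 𝓟 sf₁ sf₂) τ₀` of SECTOR-95. [formal bookkeeping] -/
theorem pairKernelCert_stepByF_of_pos {𝓟 : ChartFam} {RE τ₀ : ℝ} {βf₁ βf₂ sf₁ sf₂ : (M₀ : ℕ) → (Fin M₀ → E3) → Fin M₀ → ℝ}
    (h : PairKernelCert (famAnd 𝓘 𝓟) 𝓑 τ₁ T₁ κ σ H F X τ T (relConeBy RE βf₁ sf₁ τ₀)) :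
    PairKernelCert (famAnd 𝓘 𝓟) 𝓑 τ₁ T₁ κ σ H F X τ T (relConeBy RE (stepByF 𝓟 βf₁ βf₂) (stepByF 𝓟 sf₁ sf₂) τ₀) := by
  intro M z c M₀ z₀ c₀ e hch hb hin
  have hp : 𝓟 M₀ z₀ c₀ := hch.1.1.2
  have h₁ := h M z c M₀ z₀ c₀ e hch hb hin
  refine ⟨h₁.1, fun a b' ha hb' => ?_⟩
  have h₂ := h₁.2 a b' ha hb'
  simp only [relConeBy, stepByF_of_pos hp] at h₂ ⊢
  exact h₂

end Cert

/-! ## §2. The sector reading: (R) ∧ (E) ∧ (P₀) on the cell family, pushed into the hull family -/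

section Sector

variable {𝓘_N 𝓘₁ 𝓗 : ChartFam} {𝓑 : BalPred} {ρ ε η₂ τ₀ τ₁ τ κ σ : ℝ} {T₀ T₁ T : SlackTab} {H : HessTab} {F : ForceTab} {X : SlackTab} {B : PairTab}

/-- ★★ The kernel cut with refit target `𝓘₁` and hull `𝓗 ⊇ 𝓘₁` (the tree's `refineGB_of_kernelCut` + `RefineGB.mono`). [formal bookkeeping] -/
theorem refineGB_of_kernelCut_mono (h𝓗 : FamilyLE 𝓘₁ 𝓗) (hR : BalancedRefit 𝓘_N 𝓘₁ 𝓑 ρ ε η₂ τ₀ T₀ τ₁ T₁)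
    (hE : SlavingEnclosureG 𝓘₁ 𝓑 ρ ε η₂ τ₁ T₁ κ σ H F X) (hP : PairKernelCert 𝓘₁ 𝓑 τ₁ T₁ κ σ H F X τ T B) : RefineGB 𝓘_N 𝓗 ρ ε η₂ τ₀ T₀ τ T B :=
  (refineGB_of_kernelCut hR hE hP).mono h𝓗 (TolLE.refl T) (PairLE.refl B) le_rfl

/-- ★★ … with the IDENTITY refit (`balancedRefit_top`: `R = 1`, same host, same data `(τ₀, T₀)`, no balance). [formal bookkeeping] -/
theorem refineGB_of_kernelCut_top (h𝓗 : FamilyLE 𝓘_N 𝓗) (hE : SlavingEnclosureG 𝓘_N balTop ρ ε η₂ τ₀ T₀ κ σ H F X)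
    (hP : PairKernelCert 𝓘_N balTop τ₀ T₀ κ σ H F X τ T B) : RefineGB 𝓘_N 𝓗 ρ ε η₂ τ₀ T₀ τ T B :=
  refineGB_of_kernelCut_mono h𝓗 (balancedRefit_top (familyLE_refl 𝓘_N)) hE hP

end Sector

/-! ## §3. The record T-cell (N|𝔇) and the crux BY NAME -/

section Record

variable {𝓘₀ 𝓗 𝓘 𝓡 : ChartFam} {𝓑 : BalPred} {dA τ₁ κ σ : ℝ} {T₁ : SlackTab} {H : HessTab} {F : ForceTab} {X : SlackTab}
  {βf₁ βf₂ sf₁ sf₂ : (M₀ : ℕ) → (Fin M₀ → E3) → Fin M₀ → ℝ}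

/-- ★★★ **(N|𝔇) from the kernel cut INSIDE the cell family** `𝓘_N = famAnd (famAnd 𝓘₀ (Dense dA)) 𝓡` with any balance `𝓑` and refit data `(τ₁, T₁)`, the certificate
at the record functional `(βf₁, sf₁)` of `𝓡`-hosts, hull `𝓗 ⊇ 𝓘_N`. [folklore instantiation] -/
theorem refineGB_ND_of_kernelCut (h𝓗 : FamilyLE (famAnd (famAnd 𝓘₀ (Dense dA)) 𝓡) 𝓗)
    (hR : BalancedRefit (famAnd (famAnd 𝓘₀ (Dense dA)) 𝓡) (famAnd (famAnd 𝓘₀ (Dense dA)) 𝓡) 𝓑 (26 / 5) (1 / 100) (1 / 8) (1 / 25) (constTol (1 / 25)) τ₁ T₁)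
    (hE : SlavingEnclosureG (famAnd (famAnd 𝓘₀ (Dense dA)) 𝓡) 𝓑 (26 / 5) (1 / 100) (1 / 8) τ₁ T₁ κ σ H F X)
    (hP : PairKernelCert (famAnd (famAnd 𝓘₀ (Dense dA)) 𝓡) 𝓑 τ₁ T₁ κ σ H F X (1 / 25) (constTol (1 / 25)) (relConeBy 2 βf₁ sf₁ (1 / 25))) :
    RefineGB (famAnd (famAnd 𝓘₀ (Dense dA)) 𝓡) 𝓗 (26 / 5) (1 / 100) (1 / 8) (1 / 25) (constTol (1 / 25)) (1 / 25) (constTol (1 / 25))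
      (relConeBy 2 (stepByF 𝓡 βf₁ βf₂) (stepByF 𝓡 sf₁ sf₂) (1 / 25)) :=
  refineGB_of_kernelCut_mono h𝓗 hR hE (pairKernelCert_stepByF_of_pos hP)

/-- ★★★ **(N|𝔇) — THE INSTRUMENTED FORM: identity refit, (E κ) ∧ (P₀ κ) at the record data on the cell family** (what «HTN-LP-96» tests at `κ = 0`, host by host).
[folklore instantiation] -/
theorem refineGB_ND_of_kernelCut_top (h𝓗 : FamilyLE (famAnd (famAnd 𝓘₀ (Dense dA)) 𝓡) 𝓗)
    (hE : SlavingEnclosureG (famAnd (famAnd 𝓘₀ (Dense dA)) 𝓡) balTop (26 / 5) (1 / 100) (1 / 8) (1 / 25) (constTol (1 / 25)) κ σ H F X)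
    (hP : PairKernelCert (famAnd (famAnd 𝓘₀ (Dense dA)) 𝓡) balTop (1 / 25) (constTol (1 / 25)) κ σ H F X (1 / 25) (constTol (1 / 25))
      (relConeBy 2 βf₁ sf₁ (1 / 25))) :
    RefineGB (famAnd (famAnd 𝓘₀ (Dense dA)) 𝓡) 𝓗 (26 / 5) (1 / 100) (1 / 8) (1 / 25) (constTol (1 / 25)) (1 / 25) (constTol (1 / 25))
      (relConeBy 2 (stepByF 𝓡 βf₁ βf₂) (stepByF 𝓡 sf₁ sf₂) (1 / 25)) :=
  refineGB_ND_of_kernelCut h𝓗 (balancedRefit_top (familyLE_refl _)) hE hP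

/-- ★★ … the enclosure opened into the PROVED force cap of record (`forceCapOne`) ∧ (TFR-G κσ₁) (`slavingEnclosureG_of_taylor`). [folklore instantiation] -/
theorem refineGB_ND_of_taylor_top (h𝓗 : FamilyLE (famAnd (famAnd 𝓘₀ (Dense dA)) 𝓡) 𝓗)
    (hT : ForceTaylorBoundG (famAnd (famAnd 𝓘₀ (Dense dA)) 𝓡) balTop (26 / 5) (1 / 100) (1 / 8) (1 / 25) (constTol (1 / 25)) (κ * sigmaOne) H F X)
    (hP : PairKernelCert (famAnd (famAnd 𝓘₀ (Dense dA)) 𝓡) balTop (1 / 25) (constTol (1 / 25)) κ sigmaOne H F X (1 / 25) (constTol (1 / 25))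
      (relConeBy 2 βf₁ sf₁ (1 / 25))) :
    RefineGB (famAnd (famAnd 𝓘₀ (Dense dA)) 𝓡) 𝓗 (26 / 5) (1 / 100) (1 / 8) (1 / 25) (constTol (1 / 25)) (1 / 25) (constTol (1 / 25))
      (relConeBy 2 (stepByF 𝓡 βf₁ βf₂) (stepByF 𝓡 sf₁ sf₂) (1 / 25)) :=
  refineGB_ND_of_kernelCut_top h𝓗 (slavingEnclosureG_of_taylor hT) hP

/-- ★★★ **`AperiodicFrustratedLawGap` from the six sector cells with (N|𝔇) REPLACED by (R) ∧ (E) ∧ (P₀) on the cell family ∧ `𝓘_N ≤ 𝓗`** — literally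
`…StiffDoor.aperiodicFrustratedLawGap_of_threeSector_A35000_T26_record` with its hypothesis `hND` discharged by `refineGB_ND_of_kernelCut`. [folklore instantiation] -/
theorem aperiodicFrustratedLawGap_of_threeSector_kernelCut_A35000_T26_record {εE CE DE DX : ℝ}
    (hε0 : 0 < εE) (hε1 : εE ≤ 1 / 10000) (hDX : 0 ≤ DX)
    (hEl : SchurElasticPricingX (1 / 20) (1 / 8) w₄₅ ω₄ (3 / 400) (-(7175 / 10000)) (1 / 10000) CE DE DX (LocOptFails eStar εE (3 / 2) 1))
    (hFcc : ∃ t : CertTree (Fin 3 × Fin 3), treeOK (entryLeafOK6RBKP4 (-399210329969189)) t rootC rootW = true)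
    (hHcp : semOKH (-399210329969189) rootCH rootWH = true)
    (hT : ∀ (M : ℕ) (z : Fin M → E3) (c : Fin M), Admissible M z c → CleanBall (63 / 10) z c → MonoPhaseBall (63 / 10) z c →
      NearHomIsoAt (26 / 5) (1 / 100) z c → -(13 / 50000) ≤ ballAvg (9 / 5) z (tailOut (26 / 5) M z c) c)
    (hRl : CoreCoreRelief (63 / 10) (63 / 10) (26 / 5) (1 / 100) (3 / 5000))
    (hED : TubeFloorGB (famAnd (famAnd 𝓘 (Dense dA)) 𝓡) (1 / 25) (constTol (1 / 25)) (relConeBy 2 βf₁ sf₁ (1 / 25)))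
    (hEB : TubeFloorGB (famAndNot (famAnd 𝓘 (Dense dA)) 𝓡) (1 / 25) (constTol (1 / 25)) (relConeBy 2 βf₂ sf₂ (1 / 25)))
    (hEA : TubeFloor (famAndNot 𝓘 (Dense dA)) (1 / 25))
    (hK : FamilyCoverGRecAt 𝓘₀ (26 / 5) (1 / 100))
    (h𝓗N : FamilyLE (famAnd (famAnd 𝓘₀ (Dense dA)) 𝓡) 𝓗)
    (hR : BalancedRefit (famAnd (famAnd 𝓘₀ (Dense dA)) 𝓡) (famAnd (famAnd 𝓘₀ (Dense dA)) 𝓡) 𝓑 (26 / 5) (1 / 100) (1 / 8) (1 / 25) (constTol (1 / 25)) τ₁ T₁)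
    (hEnc : SlavingEnclosureG (famAnd (famAnd 𝓘₀ (Dense dA)) 𝓡) 𝓑 (26 / 5) (1 / 100) (1 / 8) τ₁ T₁ κ σ H F X)
    (hPC : PairKernelCert (famAnd (famAnd 𝓘₀ (Dense dA)) 𝓡) 𝓑 τ₁ T₁ κ σ H F X (1 / 25) (constTol (1 / 25)) (relConeBy 2 βf₁ sf₁ (1 / 25)))
    (hNB : RefineGB (famAndNot (famAnd 𝓘₀ (Dense dA)) 𝓡) 𝓗 (26 / 5) (1 / 100) (1 / 8) (1 / 25) (constTol (1 / 25)) (1 / 25) (constTol (1 / 25))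
      (relConeBy 2 (stepByF 𝓡 βf₁ βf₂) (stepByF 𝓡 sf₁ sf₂) (1 / 25)))
    (h𝓗 : FamilyLE (famAndNot 𝓘₀ (Dense dA)) 𝓗) (hcap : PairLE (relConeBy 2 (stepByF 𝓡 βf₁ βf₂) (stepByF 𝓡 sf₁ sf₂) (1 / 25)) (pairSum (constTol (1 / 25))))
    (h𝓘 : FamilyLE 𝓗 𝓘)
    (hF : AnnularPhaseFloor (63 / 10) (24 / 5) (63 / 10) (1 / 1000)) (hP : PolyTextureFloor (63 / 10) (24 / 5) (1 / 1000))
    (hA : AnnularDefectFloor (24 / 5) (63 / 10)) (hD : DefectiveCollarFloor (24 / 5))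
    (h2 : CrowdedCoreMotifPricingCapK (1 / 1000) (9 / 5) (133 / 10) (3 / 2) (effPot w₄₅ ω₄ (3 / 400)) (-(7175 / 10000) + 3 / 400)
      (Collar (9 / 2) fun N y j => (∃ s : ℝ, 0 ≤ s ∧ s ≤ 3 / 2 ∧ NonEquilibriumCore (-(7175 / 10000)) 0 7 s (1 / 10000) N y j) ∨
        GoodAtScale (1 / 20) (3 / 2) y j))
    (h3 : DiluteDefectMotifPricingCapK (1 / 1000) (9 / 5) (133 / 10) (3 / 2) (effPot w₄₅ ω₄ (3 / 400)) (-(7175 / 10000) + 3 / 400)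
      (Collar (9 / 2) fun N y j => (∃ s : ℝ, 0 ≤ s ∧ s ≤ 3 / 2 ∧ NonEquilibriumCore (-(7175 / 10000)) 0 7 s (1 / 10000) N y j) ∨
        GoodAtScale (1 / 20) (3 / 2) y j)) :
    Summit.AtomisticToContinuum.Crystallization.Theses.FrustratedLawDichotomy.AperiodicFrustratedLawGap :=
  aperiodicFrustratedLawGap_of_threeSector_A35000_T26_record hε0 hε1 hDX hEl hFcc hHcp hT hRl hED hEB hEA hK (refineGB_ND_of_kernelCut h𝓗N hR hEnc hPC) hNB h𝓗
    hcap h𝓘 hF hP hA hD h2 h3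

end Record

end Summit.AtomisticToContinuum.Crystallization.Theorems.FrustratedLawDichotomyStrainedPatchKernelCutSector
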